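import Summits.MatrixMultiplication.OmegaCensus.STPP222CubeCover

/-!
# ω-census, the pattern `(2,2,2)³`: the role-rotation symmetry in the assembly (fewer canonical starts)

HONEST FRAMING (pub-omega census; verbatim): lottery ticket; floor = certified bounds/negative ranges.
Census STRUCTURE bookkeeping (question Q7, row `k = 3`: the lower half `n₃ ≥ 32`), not progress on `ω`.

CKSU Def. 5.1 is invariant under the ROTATION of roles `(A, B, C) ↦ (B, C, A)` (`isSTPP_rotate`: the word at `(i,j,k)`
becomes the word at `(k,i,j)`).  `not_exists_of_cover3rot` strengthens `not_exists_of_cover3` (`STPP222CubeCover.lean`):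
the covering fact is only required for start triples passing the decided test `rotOK` — the canonical start of
`(a, dB, dC)` is not key-larger than the canonical starts obtained after rotating the roles once or twice (the new
`A`-difference `dB`, resp. `dC`, being first moved into `R1` by the first listed map doing so).  Proof: strong induction
on the encoded key; a failing test exhibits a rotation with a strictly smaller key.  Effect (ENG2's mirror `fc3.py
--s3`): Σ clause evaluations over the 14 groups of order 24–31 drops from ≈ 1.3e8 to ≈ 4.7e7.

References: H. Cohn, R. Kleinberg, B. Szegedy, C. Umans, FOCS 2005 (arXiv:math/0511460), Def. 5.1.
Record: pub-omega HOME `pub-omega-eng2/results/c4red/K2-THRESHOLD-eng2.md` §NEG3 (ENG2 gen 18, 2026-08-23).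
-/

open Literature.Computability.AlgebraicComplexity Finset

namespace Summit.MatrixMultiplication.OmegaCensus

namespace STPP222CubeNeg

open STPP222SqNeg (sg cands canon exists_of_mem_cands canon_mem_cands qcovB memTriple key3 ltKey3)

/-! ## 1. Rotation of roles -/

/-- Rotating the roles `(A, B, C) ↦ (B, C, A)` preserves the STPP. [cite: CohnKleinbergSzegedyUmans2005, Def. 5.1] -/
theorem isSTPP_rotate {G : Type} [AddCommGroup G] {N : ℕ} {A B C : Fin N → Finset G} (hS : IsSTPP A B C) :
    IsSTPP B C A := by
  intro i j k s hs s' hs' t ht t' ht' u hu u' hu' h0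
  have h0' : (u' - u) + (s' - s) + (t' - t) = 0 := by rw [← h0]; abel
  obtain ⟨hki, hij, e1, e2, e3⟩ := hS k i j u hu u' hu' s hs s' hs' t ht t' ht' h0'
  exact ⟨hij, (hki.trans hij).symm, e2, e3, e1⟩

/-! ## 2. The rotation test (kernel-evaluable) -/

/-- The first listed map moving `d` into `R1` up to sign. -/
def repMap {G : Type} [AddCommGroup G] [DecidableEq G] (auts1 : List (G →+ G)) (R1 : List G) (d : G) :
    Option (G →+ G) :=
  auts1.find? fun f => decide (f d ∈ R1 ∨ -f d ∈ R1)

/-- The representative reached: `f d` if it is in `R1`, else `-f d`. -/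
def repVal {G : Type} [AddCommGroup G] [DecidableEq G] (R1 : List G) (f : G →+ G) (d : G) : G :=
  if f d ∈ R1 then f d else -f d

/-- Encoded lexicographic key of a code triple (radix `R`). -/
def encK (R : ℕ) (k : ℕ × ℕ × ℕ) : ℕ := (k.1 * R + k.2.1) * R + k.2.2

/-- One rotation test: with `x` the new `A`-difference and `(y, z)` the new `(B, C)`-differences, the canonical start
after moving `x` into `R1` by the first listed map is NOT key-smaller than the canonical start of `(a, dB, dC)`. -/
def rotLe {G : Type} [AddCommGroup G] [DecidableEq G] (E : Enc3 G) (auts1 : List (G →+ G)) (R1 : List G)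
    (stab : G → List (G →+ G)) (a dB dC x y z : G) : Bool :=
  match repMap auts1 R1 x with
  | none => true
  | some f => !ltKey3 (key3 E.toEnc (canon E.toEnc (stab (repVal R1 f x)) (repVal R1 f x) (f y) (f z)))
      (key3 E.toEnc (canon E.toEnc (stab a) a dB dC))

/-- The rotation test of a start `(a, dB, dC)`: both role rotations give no key-smaller canonical start. -/
def rotOK {G : Type} [AddCommGroup G] [DecidableEq G] (E : Enc3 G) (auts1 : List (G →+ G)) (R1 : List G)
    (stab : G → List (G →+ G)) (a dB dC : G) : Bool :=
  rotLe E auts1 R1 stab a dB dC dB dC a && rotLe E auts1 R1 stab a dB dC dC a dB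

/-- Lexicographic comparison step. -/
theorem lex_lt {a b c d R : ℕ} (hab : a < b) (hc : c < R) : a * R + c < b * R + d :=
  calc a * R + c < a * R + R := by omega
    _ = (a + 1) * R := by ring
    _ ≤ b * R := Nat.mul_le_mul_right _ hab
    _ ≤ b * R + d := Nat.le_add_right _ _

/-- `ltKey3` implies `<` of the encoded keys when the lower components are below the radix. -/
theorem encK_lt_of_ltKey3 {R : ℕ} {x y : ℕ × ℕ × ℕ} (hx1 : x.2.1 < R) (hx2 : x.2.2 < R) (h : ltKey3 x y = true) :
    encK R x < encK R y := by
  unfold ltKey3 at h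
  unfold encK
  simp only [Bool.or_eq_true, Bool.and_eq_true, Nat.blt_eq, beq_iff_eq] at h
  rcases h with h | ⟨h1, h | ⟨h2, h⟩⟩
  · exact lex_lt (lex_lt h hx1) hx2
  · rw [h1]; exact lex_lt (by omega) hx2
  · rw [h1, h2]; omega

/-- Components of a canonical start are codes, hence at most the offset. -/
theorem canon_le {G : Type} [AddCommGroup G] [DecidableEq G] (E : Enc3 G) (fs : List (G →+ G)) (a dB dC : G) :
    (canon E.toEnc fs a dB dC).2.1 ≤ E.A.off ∧ (canon E.toEnc fs a dB dC).2.2 ≤ E.A.off := by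
  obtain ⟨g, -, -, sw, ε₂, ε₃, ht⟩ := exists_of_mem_cands E.toEnc fs a dB dC (canon_mem_cands E.toEnc fs a dB dC)
  rw [ht]
  exact ⟨E.enc_le _, E.enc_le _⟩

/-- Unpacking a successful `repMap`. -/
theorem repMap_spec {G : Type} [AddCommGroup G] [DecidableEq G] {auts1 : List (G →+ G)} {R1 : List G} {d : G}
    {f : G →+ G} (h : repMap auts1 R1 d = some f) : f ∈ auts1 ∧ repVal R1 f d ∈ R1 ∧
    (repVal R1 f d = f d ∨ repVal R1 f d = -f d) := by
  refine ⟨List.mem_of_find?_eq_some h, ?_, ?_⟩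
  · have h' := List.find?_some h
    simp only [decide_eq_true_eq] at h'
    unfold repVal
    split_ifs with hm
    · exact hm
    · exact h'.resolve_left hm
  · unfold repVal; split_ifs <;> simp

/-! ## 3. The assembly theorem with the rotation test -/

/-- Strong induction on the encoded key of the canonical start: a family with named elements whose `A 0`-difference is
in `R1` cannot exist, given the covering fact for starts passing `rotOK`. [cite: CohnKleinbergSzegedyUmans2005, Def. 5.1] -/
theorem contra3rot {G : Type} [AddCommGroup G] [DecidableEq G] (E : Enc3 G) {el : List ℕ} (hel : ∀ g : G, E.enc g ∈ el)
    {reps : List (ℕ × ℕ × ℕ × List ℕ)} (hs : searchB3 E.A el reps = true) (hq : qcovB el reps = true)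
    (auts1 : List (G →+ G)) (hinj1 : ∀ f ∈ auts1, Function.Injective f) (R1 : List G) (stab : G → List (G →+ G))
    (hinjS : ∀ a ∈ R1, ∀ f ∈ stab a, Function.Injective f)
    (hC2 : ∀ a ∈ R1, ∀ dB dC : G, dB ≠ 0 → dC ≠ 0 → rotOK E auts1 R1 stab a dB dC = true →
      startBad E.A (startCfg (canon E.toEnc (stab a) a dB dC).1 (canon E.toEnc (stab a) a dB dC).2.1
        (canon E.toEnc (stab a) a dB dC).2.2) = false → memTriple (canon E.toEnc (stab a) a dB dC) reps = true)
    (n : ℕ) : ∀ {A B C : Fin 3 → Finset G}, IsSTPP A B C → ∀ {x₀ x₁ y₀ y₁ z₀ z₁ m₀ m₁ n₀ n₁ k₀ k₁ o₀ o₁ p₀ p₁ l₀ l₁ : G},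
      x₀ ∈ A 0 → x₁ ∈ A 0 → x₀ ≠ x₁ → y₀ ∈ A 1 → y₁ ∈ A 1 → y₀ ≠ y₁ → z₀ ∈ A 2 → z₁ ∈ A 2 → z₀ ≠ z₁ →
      m₀ ∈ B 0 → m₁ ∈ B 0 → m₀ ≠ m₁ → n₀ ∈ B 1 → n₁ ∈ B 1 → n₀ ≠ n₁ → k₀ ∈ B 2 → k₁ ∈ B 2 → k₀ ≠ k₁ →
      o₀ ∈ C 0 → o₁ ∈ C 0 → o₀ ≠ o₁ → p₀ ∈ C 1 → p₁ ∈ C 1 → p₀ ≠ p₁ → l₀ ∈ C 2 → l₁ ∈ C 2 → l₀ ≠ l₁ →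
      ∀ {a : G}, a ∈ R1 → x₁ - x₀ = a →
      encK (E.A.off + 1) (key3 E.toEnc (canon E.toEnc (stab a) a (m₁ - m₀) (o₁ - o₀))) = n → False := by
  induction n using Nat.strong_induction_on with
  | _ n ih =>
  intro A B C hS x₀ x₁ y₀ y₁ z₀ z₁ m₀ m₁ n₀ n₁ k₀ k₁ o₀ o₁ p₀ p₁ l₀ l₁ hx₀ hx₁ hx hy₀ hy₁ hy hz₀ hz₁ hz hm₀ hm₁ hm hn₀ hn₁
    hn hk₀ hk₁ hk ho₀ ho₁ ho hp₀ hp₁ hp hl₀ hl₁ hl a haR hxa hn_eq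
  have hdB0 : m₁ - m₀ ≠ 0 := sub_ne_zero.2 (Ne.symm hm)
  have hdC0 : o₁ - o₀ ≠ 0 := sub_ne_zero.2 (Ne.symm ho)
  by_cases hrot : rotOK E auts1 R1 stab a (m₁ - m₀) (o₁ - o₀) = true
  · exact contra3_of_R1 E hel hs hq (stab a) (hinjS a haR) hS hx₀ hx₁ hx hxa hy₀ hy₁ hy hz₀ hz₁ hz hm₀ hm₁ hm hn₀ hn₁ hn
      hk₀ hk₁ hk ho₀ ho₁ ho hp₀ hp₁ hp hl₀ hl₁ hl (hC2 a haR _ _ hdB0 hdC0 hrot)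
  -- a rotation gives a strictly smaller key
  rw [Bool.not_eq_true, rotOK, Bool.and_eq_false_iff] at hrot
  rcases hrot with hr | hr
  · -- rotate once: roles (B, C, A); new A-difference dB = m₁ - m₀
    unfold rotLe at hr
    cases hf : repMap auts1 R1 (m₁ - m₀) with
    | none => rw [hf] at hr; exact Bool.noConfusion hr
    | some f =>
      rw [hf] at hr
      simp only [Bool.not_eq_false'] at hr
      obtain ⟨hfm, ha₁R, hor⟩ := repMap_spec hf
      have hfi := hinj1 f hfm
      set a₁ := repVal R1 f (m₁ - m₀) with ha₁
      have hlt : encK (E.A.off + 1) (key3 E.toEnc (canon E.toEnc (stab a₁) a₁ (f (o₁ - o₀)) (f a))) < n := by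
        rw [← hn_eq]
        have hc := canon_le E (stab a₁) a₁ (f (o₁ - o₀)) (f a)
        exact encK_lt_of_ltKey3 (x := key3 E.toEnc (canon E.toEnc (stab a₁) a₁ (f (o₁ - o₀)) (f a)))
          (Nat.lt_succ_of_le hc.1) (Nat.lt_succ_of_le hc.2) hr
      have hS' : IsSTPP (fun t => (B t).image f) (fun t => (C t).image f) (fun t => (A t).image f) :=
        (isSTPP_rotate hS).image f hfi
      have I : ∀ {S : Finset G} {u : G}, u ∈ S → f u ∈ S.image f := fun h => mem_image_of_mem f h
      have D : ∀ {u v : G}, u ≠ v → f u ≠ f v := fun h e => h (hfi e)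
      -- orientation of the new `A 0` pair (B 0's elements) so that its difference is `a₁`
      rcases hor with h1 | h1
      · refine ih _ hlt hS' (I hm₀) (I hm₁) (D hm) (I hn₀) (I hn₁) (D hn) (I hk₀) (I hk₁) (D hk) (I ho₀) (I ho₁) (D ho)
          (I hp₀) (I hp₁) (D hp) (I hl₀) (I hl₁) (D hl) (I hx₀) (I hx₁) (D hx) (I hy₀) (I hy₁) (D hy) (I hz₀) (I hz₁)
          (D hz) ha₁R (by rw [← map_sub, ← h1]) ?_
        rw [← map_sub, ← map_sub, hxa]
      · refine ih _ hlt hS' (I hm₁) (I hm₀) (D hm).symm (I hn₀) (I hn₁) (D hn) (I hk₀) (I hk₁) (D hk) (I ho₀) (I ho₁)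
          (D ho) (I hp₀) (I hp₁) (D hp) (I hl₀) (I hl₁) (D hl) (I hx₀) (I hx₁) (D hx) (I hy₀) (I hy₁) (D hy) (I hz₀)
          (I hz₁) (D hz) ha₁R (by rw [← map_sub, ← neg_sub, map_neg, ← h1]) ?_
        rw [← map_sub, ← map_sub, hxa]
  · -- rotate twice: roles (C, A, B); new A-difference dC = o₁ - o₀
    unfold rotLe at hr
    cases hf : repMap auts1 R1 (o₁ - o₀) with
    | none => rw [hf] at hr; exact Bool.noConfusion hr
    | some g =>
      rw [hf] at hr
      simp only [Bool.not_eq_false'] at hr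
      obtain ⟨hgm, ha₂R, hor⟩ := repMap_spec hf
      have hgi := hinj1 g hgm
      set a₂ := repVal R1 g (o₁ - o₀) with ha₂
      have hlt : encK (E.A.off + 1) (key3 E.toEnc (canon E.toEnc (stab a₂) a₂ (g a) (g (m₁ - m₀)))) < n := by
        rw [← hn_eq]
        have hc := canon_le E (stab a₂) a₂ (g a) (g (m₁ - m₀))
        exact encK_lt_of_ltKey3 (x := key3 E.toEnc (canon E.toEnc (stab a₂) a₂ (g a) (g (m₁ - m₀))))
          (Nat.lt_succ_of_le hc.1) (Nat.lt_succ_of_le hc.2) hr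
      have hS' : IsSTPP (fun t => (C t).image g) (fun t => (A t).image g) (fun t => (B t).image g) :=
        (isSTPP_rotate (isSTPP_rotate hS)).image g hgi
      have I : ∀ {S : Finset G} {u : G}, u ∈ S → g u ∈ S.image g := fun h => mem_image_of_mem g h
      have D : ∀ {u v : G}, u ≠ v → g u ≠ g v := fun h e => h (hgi e)
      rcases hor with h1 | h1
      · refine ih _ hlt hS' (I ho₀) (I ho₁) (D ho) (I hp₀) (I hp₁) (D hp) (I hl₀) (I hl₁) (D hl) (I hx₀) (I hx₁) (D hx)
          (I hy₀) (I hy₁) (D hy) (I hz₀) (I hz₁) (D hz) (I hm₀) (I hm₁) (D hm) (I hn₀) (I hn₁) (D hn) (I hk₀) (I hk₁)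
          (D hk) ha₂R (by rw [← map_sub, ← h1]) ?_
        rw [← map_sub, ← map_sub, hxa]
      · refine ih _ hlt hS' (I ho₁) (I ho₀) (D ho).symm (I hp₀) (I hp₁) (D hp) (I hl₀) (I hl₁) (D hl) (I hx₀) (I hx₁)
          (D hx) (I hy₀) (I hy₁) (D hy) (I hz₀) (I hz₁) (D hz) (I hm₀) (I hm₁) (D hm) (I hn₀) (I hn₁) (D hn) (I hk₀)
          (I hk₁) (D hk) ha₂R (by rw [← map_sub, ← neg_sub, map_neg, ← h1]) ?_
        rw [← map_sub, ← map_sub, hxa]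

/-- ASSEMBLY THEOREM with the rotation test: as `not_exists_of_cover3`, but the covering fact `hC2` is only required for
`(a, dB, dC)` passing `rotOK`. [cite: CohnKleinbergSzegedyUmans2005, Def. 5.1] -/
theorem not_exists_of_cover3rot {G : Type} [AddCommGroup G] [DecidableEq G] (E : Enc3 G) (el : List ℕ)
    (hel : ∀ g : G, E.enc g ∈ el) (reps : List (ℕ × ℕ × ℕ × List ℕ)) (hs : searchB3 E.A el reps = true)
    (hq : qcovB el reps = true) (elG : List G) (helG : ∀ x : G, x ∈ elG) (R1 : List G) (auts1 : List (G →+ G))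
    (hinj1 : ∀ f ∈ auts1, Function.Injective f) (hC1 : ∀ d ∈ elG, d ≠ 0 → ∃ f ∈ auts1, f d ∈ R1 ∨ -f d ∈ R1)
    (stab : G → List (G →+ G)) (hinjS : ∀ a ∈ R1, ∀ f ∈ stab a, Function.Injective f)
    (hC2 : ∀ a ∈ R1, ∀ dB ∈ elG, ∀ dC ∈ elG, dB ≠ 0 → dC ≠ 0 → rotOK E auts1 R1 stab a dB dC = true →
      startBad E.A (startCfg (canon E.toEnc (stab a) a dB dC).1 (canon E.toEnc (stab a) a dB dC).2.1
        (canon E.toEnc (stab a) a dB dC).2.2) = false → memTriple (canon E.toEnc (stab a) a dB dC) reps = true) :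
    ¬ ∃ A B C : Fin 3 → Finset G, IsSTPP A B C ∧ ∀ i, (A i).card = 2 ∧ (B i).card = 2 ∧ (C i).card = 2 := by
  rintro ⟨A, B, C, hS, hcard⟩
  obtain ⟨x₀, x₁, hx, hA0⟩ := Finset.card_eq_two.1 (hcard 0).1
  obtain ⟨y₀, y₁, hy, hA1⟩ := Finset.card_eq_two.1 (hcard 1).1
  obtain ⟨z₀, z₁, hz, hA2⟩ := Finset.card_eq_two.1 (hcard 2).1
  obtain ⟨m₀, m₁, hm, hB0⟩ := Finset.card_eq_two.1 (hcard 0).2.1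
  obtain ⟨n₀, n₁, hn, hB1⟩ := Finset.card_eq_two.1 (hcard 1).2.1
  obtain ⟨k₀, k₁, hk, hB2⟩ := Finset.card_eq_two.1 (hcard 2).2.1
  obtain ⟨o₀, o₁, ho, hCC0⟩ := Finset.card_eq_two.1 (hcard 0).2.2
  obtain ⟨p₀, p₁, hp, hCC1⟩ := Finset.card_eq_two.1 (hcard 1).2.2
  obtain ⟨l₀, l₁, hl, hCC2⟩ := Finset.card_eq_two.1 (hcard 2).2.2
  have M : ∀ {S : Finset G} {u v : G}, S = {u, v} → u ∈ S ∧ v ∈ S := fun h => by subst h; simp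
  have hd : x₁ - x₀ ≠ 0 := sub_ne_zero.2 (Ne.symm hx)
  obtain ⟨f, hf, hfR⟩ := hC1 (x₁ - x₀) (helG _) hd
  have hfi := hinj1 f hf
  have hS₁ : IsSTPP (fun t => (A t).image f) (fun t => (B t).image f) (fun t => (C t).image f) := hS.image f hfi
  have I : ∀ {S : Finset G} {u : G}, u ∈ S → f u ∈ S.image f := fun h => mem_image_of_mem f h
  have D : ∀ {u v : G}, u ≠ v → f u ≠ f v := fun h e => h (hfi e)
  have hC2' : ∀ a ∈ R1, ∀ dB dC : G, dB ≠ 0 → dC ≠ 0 → rotOK E auts1 R1 stab a dB dC = true →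
      startBad E.A (startCfg (canon E.toEnc (stab a) a dB dC).1 (canon E.toEnc (stab a) a dB dC).2.1
        (canon E.toEnc (stab a) a dB dC).2.2) = false → memTriple (canon E.toEnc (stab a) a dB dC) reps = true :=
    fun a ha dB dC => hC2 a ha dB (helG _) dC (helG _)
  rcases hfR with h | h
  · exact contra3rot E hel hs hq auts1 hinj1 R1 stab hinjS hC2' _ hS₁ (I (M hA0).1) (I (M hA0).2) (D hx) (I (M hA1).1)
      (I (M hA1).2) (D hy) (I (M hA2).1) (I (M hA2).2) (D hz) (I (M hB0).1) (I (M hB0).2) (D hm) (I (M hB1).1) (I (M hB1).2)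
      (D hn) (I (M hB2).1) (I (M hB2).2) (D hk) (I (M hCC0).1) (I (M hCC0).2) (D ho) (I (M hCC1).1) (I (M hCC1).2) (D hp)
      (I (M hCC2).1) (I (M hCC2).2) (D hl) h (by rw [map_sub]) rfl
  · exact contra3rot E hel hs hq auts1 hinj1 R1 stab hinjS hC2' _ hS₁ (I (M hA0).2) (I (M hA0).1) (D hx).symm (I (M hA1).1)
      (I (M hA1).2) (D hy) (I (M hA2).1) (I (M hA2).2) (D hz) (I (M hB0).1) (I (M hB0).2) (D hm) (I (M hB1).1) (I (M hB1).2)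
      (D hn) (I (M hB2).1) (I (M hB2).2) (D hk) (I (M hCC0).1) (I (M hCC0).2) (D ho) (I (M hCC1).1) (I (M hCC1).2) (D hp)
      (I (M hCC2).1) (I (M hCC2).2) (D hl) h (by rw [map_sub, neg_sub]) rfl

/-! ## 4. Boolean form of the covering test (the compact shape decided piecewise by the per-group files) -/

/-- Boolean form of the covering test of a start `(a, dB, dC)`: the rotation test fails, or the canonical start triple
is rejected by the start guard, or it is a listed start. -/
noncomputable def covB {G : Type} [AddCommGroup G] [DecidableEq G] (E : Enc3 G) (auts1 : List (G →+ G)) (R1 : List G)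
    (stab : G → List (G →+ G)) (reps : List (ℕ × ℕ × ℕ × List ℕ)) (a dB dC : G) : Bool :=
  !rotOK E auts1 R1 stab a dB dC ||
    (startBad E.A (startCfg (canon E.toEnc (stab a) a dB dC).1 (canon E.toEnc (stab a) a dB dC).2.1
        (canon E.toEnc (stab a) a dB dC).2.2) ||
      memTriple (canon E.toEnc (stab a) a dB dC) reps)

/-- Reading the Boolean covering test back as the implication used by `not_exists_of_cover3rot`. -/
theorem covB_spec {G : Type} [AddCommGroup G] [DecidableEq G] {E : Enc3 G} {auts1 : List (G →+ G)} {R1 : List G}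
    {stab : G → List (G →+ G)} {reps : List (ℕ × ℕ × ℕ × List ℕ)} {a dB dC : G}
    (h : covB E auts1 R1 stab reps a dB dC = true) (hrot : rotOK E auts1 R1 stab a dB dC = true)
    (hsb : startBad E.A (startCfg (canon E.toEnc (stab a) a dB dC).1 (canon E.toEnc (stab a) a dB dC).2.1
        (canon E.toEnc (stab a) a dB dC).2.2) = false) :
    memTriple (canon E.toEnc (stab a) a dB dC) reps = true := by
  rw [covB, hrot, hsb] at h
  simpa using h

/-- ASSEMBLY THEOREM with the rotation test and the Boolean covering fact `covB` (the form the per-group files decide,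
one `decide +kernel` per representative `a ∈ R1` and block of `dB`). [cite: CohnKleinbergSzegedyUmans2005, Def. 5.1] -/
theorem not_exists_of_cover3rotB {G : Type} [AddCommGroup G] [DecidableEq G] (E : Enc3 G) (el : List ℕ)
    (hel : ∀ g : G, E.enc g ∈ el) (reps : List (ℕ × ℕ × ℕ × List ℕ)) (hs : searchB3 E.A el reps = true)
    (hq : qcovB el reps = true) (elG : List G) (helG : ∀ x : G, x ∈ elG) (R1 : List G) (auts1 : List (G →+ G))
    (hinj1 : ∀ f ∈ auts1, Function.Injective f) (hC1 : ∀ d ∈ elG, d ≠ 0 → ∃ f ∈ auts1, f d ∈ R1 ∨ -f d ∈ R1)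
    (stab : G → List (G →+ G)) (hinjS : ∀ a ∈ R1, ∀ f ∈ stab a, Function.Injective f)
    (hC2 : ∀ a ∈ R1, ∀ dB ∈ elG, ∀ dC ∈ elG, dB ≠ 0 → dC ≠ 0 → covB E auts1 R1 stab reps a dB dC = true) :
    ¬ ∃ A B C : Fin 3 → Finset G, IsSTPP A B C ∧ ∀ i, (A i).card = 2 ∧ (B i).card = 2 ∧ (C i).card = 2 :=
  not_exists_of_cover3rot E el hel reps hs hq elG helG R1 auts1 hinj1 hC1 stab hinjS
    fun a ha dB hdB dC hdC hB hC hrot hsb => covB_spec (hC2 a ha dB hdB dC hdC hB hC) hrot hsb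

end STPP222CubeNeg

end Summit.MatrixMultiplication.OmegaCensus
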